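import Mathlib
import HarnessLib
import Literature.AlgebraicGeometry.Resolution.AugmentationIdeal
import Literature.AlgebraicGeometry.Resolution.RegularLocalRingsNormal

/-!
# Király–Lütkebohmert's regularity criterion for invariants of `p`-cyclic actions (Theorem 2)

Topic: `Literature/AlgebraicGeometry/Resolution` (companion of `AugmentationIdeal.lean`, which
vendors the vocabulary of [KiralyLutkebohmert2013, §1] and announces this theorem as "not here").

Let `B` be a normal local ring, `p` a prime and `G = ⟨σ⟩` a cyclic group of order `p` of (local)
ring automorphisms of `B`; let `I_G = (σ b - b ; b ∈ B) · B` be the augmentation ideal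
(`augIdeal σ`) and `A := B^G` the ring of invariants — here the subring
`(σ : B →+* B).eqLocus (RingHom.id B)` of `σ`-fixed elements, over which `B` is an algebra by
restriction of scalars (`Algebra.ofSubring`). Király–Lütkebohmert [KiralyLutkebohmert2013, Thm. 2]
prove:

* first part (any normal local `B`): (a) `I_G` principal ⟺ (b) `B` is a monogenous `A`-algebra
  ⟹ (c) `B` is a free `A`-module;
* second part (`B` moreover regular): (c) ⟹ (d) `A` is regular (proof: `B` is Noetherian, `A → B`
  is faithfully flat hence `A` Noetherian, then Matsumura 23.7 — in tree as
  `IsRegularLocalRing.of_flat_of_isLocalHom`); and, when `k_A ⥲ k_B`, (a) ⟺ (e) `G` acts as a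
  pseudo-reflection (not vendored).

Both parts are vendored as NAMED FACTS (`def … : Prop`, users take `(h : …)`), in a weak form
implied by the printed statement: `B` is assumed Noetherian (harmless: the application is to
regular `B`), the group is presented by a generator `σ` with `σ ≠ 1`, `σ ^ p = 1` (so `⟨σ⟩` has
order exactly `p`, `p` prime; every ring automorphism of a local ring is local), and (e) is
omitted. The corollary `KiralyLutkebohmert2013_thm2_regular_of_isPrincipal` — (a) ⟹ (d) for regular
`B` — is the terminal criterion of the equivariant blow-up game of route
`ResolutionOfSingularities/WildQuotients` (support item `KiralyLutkebohmert`,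
stmt-ResolutionOfSingularities-15643, whose signature it reproduces literally); it is proved here
from the two named facts and the tree's `isDomain_of_isRegularLocalRing`,
`isIntegrallyClosed_of_isRegularLocalRing` (regular local rings are normal domains).

## Sources

* F. Király, W. Lütkebohmert, *Group actions of prime order on local normal rings*, Algebra &
  Number Theory 7 (2013) 63–74 (= arXiv:1001.1945), Theorem 2 (p. 64 / arXiv p. 1) and its proof,
  "Proof of the second part": "(c)→(d) follows from [Matsumura]. Namely, B is noetherian due to
  the definition of a regular ring. Since A → B is faithfully flat, so A is noetherian."
  [KiralyLutkebohmert2013]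
-/

namespace Literature.AlgebraicGeometry.Resolution

universe u

/-- NAMED FACT — **Király–Lütkebohmert 2013, Theorem 2, first part** ("Let `B` be a normal local
ring … `p` a prime number and `G` a `p`-cyclic group of local automorphisms of `B`. Let `I_G` be
the augmentation ideal. Let `A` be the ring of `G`-invariants of `B`. Consider the following
conditions: (a) `I_G := B · I(B)` is principal. (b) `B` is a monogenous `A`-algebra. (c) `B` is a
free `A`-module. Then the following implications are true: (a) ⟷ (b) ⟶ (c)").
Weak vendored form: `B` a Noetherian normal local domain, `G = ⟨σ⟩` with `σ ≠ 1`, `σ ^ p = 1`;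
`A` = the subring of `σ`-invariants `(σ : B →+* B).eqLocus (RingHom.id B)`; "monogenous" =
`Algebra.adjoin A {y} = ⊤` for some `y`; "free" = `Module.Free A B`.
Users take `(h : KiralyLutkebohmert2013_thm2_first)`.
[cite: KiralyLutkebohmert2013, Thm. 2 (first part: (a) ⟺ (b) ⟹ (c))] -/
def KiralyLutkebohmert2013_thm2_first : Prop :=
  ∀ (B : Type u) [CommRing B] [IsDomain B] [IsIntegrallyClosed B] [IsNoetherianRing B]
    [IsLocalRing B] (p : ℕ), p.Prime → ∀ σ : B ≃+* B, σ ≠ RingEquiv.refl B →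
    σ ^ p = RingEquiv.refl B →
      ((augIdeal σ).IsPrincipal ↔
          ∃ y : B, Algebra.adjoin ((σ : B →+* B).eqLocus (RingHom.id B)) ({y} : Set B) = ⊤) ∧
      ((∃ y : B, Algebra.adjoin ((σ : B →+* B).eqLocus (RingHom.id B)) ({y} : Set B) = ⊤) →
          Module.Free ((σ : B →+* B).eqLocus (RingHom.id B)) B)

/-- NAMED FACT — **Király–Lütkebohmert 2013, Theorem 2, second part** ("Assume, in addition, that
`B` is regular. Consider the following conditions: (d) `A` is regular. (e) `G` acts as a
pseudo-reflection. Then the condition (c) implies (d)."; the printed proof: `B` is Noetherian,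
`A → B` is faithfully flat, hence `A` is Noetherian, then [Matsumura, Thm. 23.7]).
Weak vendored form ((e) and the residue-field clause omitted): for a regular local ring `B`, a
prime `p` and `σ : B ≃+* B` with `σ ≠ 1`, `σ ^ p = 1`, if `B` is a free module over the subring
`A` of `σ`-invariants then `A` is a regular local ring.
Users take `(h : KiralyLutkebohmert2013_thm2_second)`.
[cite: KiralyLutkebohmert2013, Thm. 2 (second part: (c) ⟹ (d))] -/
def KiralyLutkebohmert2013_thm2_second : Prop :=
  ∀ (B : Type u) [CommRing B] [IsRegularLocalRing B] (p : ℕ), p.Prime → ∀ σ : B ≃+* B,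
    σ ≠ RingEquiv.refl B → σ ^ p = RingEquiv.refl B →
      Module.Free ((σ : B →+* B).eqLocus (RingHom.id B)) B →
        IsRegularLocalRing ((σ : B →+* B).eqLocus (RingHom.id B))

/-- **Király–Lütkebohmert's criterion, (a) ⟹ (d)** (Theorem 2 chained: principal augmentation
ideal ⟹ monogenous ⟹ free ⟹ invariants regular), for a REGULAR local ring `B` — regular local
rings being normal domains (`isDomain_of_isRegularLocalRing`,
`isIntegrallyClosed_of_isRegularLocalRing`, Matsumura 14.3 / 19.4, in tree). This is literally the
signature of route `WildQuotients`' support item `KiralyLutkebohmert`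
(stmt-ResolutionOfSingularities-15643), conditional on the two named facts; it grounds
`Summit.ResolutionOfSingularities.ResolutionOfSingularities.Theses.WildQuotients.KiralyLutkebohmert`.
[cite: KiralyLutkebohmert2013, Thm. 2 ((a) ⟹ (b) ⟹ (c) ⟹ (d))] -/
theorem KiralyLutkebohmert2013_thm2_regular_of_isPrincipal
    (h₁ : KiralyLutkebohmert2013_thm2_first.{u}) (h₂ : KiralyLutkebohmert2013_thm2_second.{u}) :
    ∀ p : ℕ, p.Prime → ∀ (B : Type u) [CommRing B] [IsRegularLocalRing B] (σ : B ≃+* B),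
      σ ≠ RingEquiv.refl B → σ ^ p = RingEquiv.refl B →
      (Ideal.span (Set.range fun b : B => σ b - b)).IsPrincipal →
        IsRegularLocalRing ((σ : B →+* B).eqLocus (RingHom.id B)) := by
  intro p hp B _ _ σ hσ hσp hI
  haveI : IsDomain B := isDomain_of_isRegularLocalRing B
  haveI : IsIntegrallyClosed B := isIntegrallyClosed_of_isRegularLocalRing B
  obtain ⟨hab, hbc⟩ := h₁ B p hp σ hσ hσp
  exact h₂ B p hp σ hσ hσp (hbc (hab.1 hI))

end Literature.AlgebraicGeometry.Resolution
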